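import Summits.Ventures.PercRepro.ProfilePointedCircuitClassesTwelveSeriesB

/-!
# PercRepro — `InOutBottomFive` AT EVERY POINT OF A SERIES PAIR, FOR EVERY RANK `ρ ≥ 7`
(p5, gen 45; `proofs/P5-GM1.md` §67)

On `#E = ρ(E) + 5`, `ρ(E) ≥ 7`, let `{e, e'}` be a series pair (a 2-cocircuit) of `N`.  Every bi-independent
`5`-set through `e` avoids `e'` and is the trace `Y + e` of a bi-independent `4`-set `Y` of the nullity-`4` minor
`N₁ := N ／ e ∖ e'` (`mem_biIndepSets_minor_iff_insert_left_of_seriesPair`), so `in_5(e) = P_4(N₁)`; the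
bi-independent `6`-sets `S ∋ e'` avoiding `e` are the traces `T + e'` of the bi-independent `5`-sets `T` of
`N₁`, so `out_6(e) ≥ P_5(N₁)`; and Theorem A's step at the level `4` of nullity `4`
(`biIndep_step_four_of_nullity_four`: `(n₁ − 4)·P_4 ≤ 5·P_5` with `n₁ − 4 = ρ − 1 ≥ 6`) gives `P_4 ≤ P_5`.
Hence `in_5(e) ≤ out_6(e)` — a new unconditional regime of `InOutBottomFive` (and of the twelve-point
statement): EVERY POINT LYING IN A SERIES PAIR.  Together with the series-triple regime of TwelveSeriesD this
makes every point of a non-cosimple `12`-point matroid either settled (in a series class) or avoided by a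
series pair (the capture reduction of TwelveCaptureB).
-/

open scoped Matroid

namespace PercRepro.Cogirth

open Finset ThmH Skew Shadow Profile

variable {α : Type} [DecidableEq α] {N : Matroid α} [N.Finite]

section FiveSeriesMem

/-- `in_5(e) = P_4(N ／ e ∖ e')` for a series pair `{e, e'}` on `#E = ρ(E) + 5`: the bi-independent `5`-sets through
`e` avoid `e'` and are the traces `Y + e` of the bi-independent `4`-sets of the minor. -/
theorem inCount_five_eq_card_biIndepSets_four_minor_of_seriesPair (hn : (gr N).card = rk N (gr N) + 5)
    {e e' : α} (h : SeriesPair N e e') :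
    inCount N 5 e = (biIndepSets ((N ／ ({e} : Set α)) ＼ ({e'} : Set α)) 4).card := by
  have h1 := card_filter_minor_insert_left_eq_of_seriesPair h 4 (fun _ => True) (fun _ => Iff.rfl)
  simp only [Nat.reduceAdd] at h1
  rw [filter_true_of_mem (fun _ _ => trivial)] at h1
  rw [h1]
  unfold inCount
  apply congrArg Finset.card
  apply filter_congr
  intro W hW
  constructor
  · intro heW
    exact ⟨⟨trivial, heW⟩, not_mem_of_mem_biIndepSets_of_seriesPair h hn hW heW⟩
  · rintro ⟨⟨_, heW⟩, _⟩
    exact heW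

/-- `P_5(N ／ e ∖ e') ≤ out_6(e)` for a series pair `{e, e'}`: the bi-independent `5`-sets of the minor lift to the
bi-independent `6`-sets of `N` containing `e'` but not `e`. -/
theorem card_biIndepSets_five_minor_le_outCount_six_of_seriesPair {e e' : α} (h : SeriesPair N e e') :
    (biIndepSets ((N ／ ({e} : Set α)) ＼ ({e'} : Set α)) 5).card ≤ outCount N 6 e := by
  have h1 := card_filter_minor_insert_right_eq_of_seriesPair h 5 (fun _ => True) (fun _ => Iff.rfl)
  simp only [Nat.reduceAdd] at h1
  rw [filter_true_of_mem (fun _ _ => trivial)] at h1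
  rw [h1]
  unfold outCount
  apply card_le_card
  intro W hW
  rw [mem_filter] at hW ⊢
  exact ⟨hW.1, hW.2.1.2⟩

/-- **`InOutBottomFive` AT EVERY POINT OF A SERIES PAIR**: on `#E = ρ(E) + 5` with `ρ(E) ≥ 7`, if `{e, e'}` is a
series pair of `N` then `in_5(e) ≤ out_6(e)` — `in_5(e) = P_4(N₁) ≤ P_5(N₁) ≤ out_6(e)` on the nullity-`4` minor
`N₁ = N ／ e ∖ e'` of rank `ρ − 1 ≥ 6` (Theorem A's step `(n₁ − 4)·P_4 ≤ 5·P_5`, `n₁ − 4 = ρ − 1 ≥ 6`). -/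
theorem inCount_five_le_outCount_six_of_seriesPair_mem (hn : (gr N).card = rk N (gr N) + 5)
    (hR : 7 ≤ rk N (gr N)) {e e' : α} (h : SeriesPair N e e') : inCount N 5 e ≤ outCount N 6 e := by
  have hN₁n := card_gr_minor_add_two_of_seriesPair h
  have hN₁r := rk_gr_minor_add_one_of_seriesPair h
  have hstep := biIndep_step_four_of_nullity_four (N := (N ／ ({e} : Set α)) ＼ ({e'} : Set α))
    (by omega) (by omega)
  have h6 : 6 * (biIndepSets ((N ／ ({e} : Set α)) ＼ ({e'} : Set α)) 4).card ≤
      ((gr ((N ／ ({e} : Set α)) ＼ ({e'} : Set α))).card - 4) *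
        (biIndepSets ((N ／ ({e} : Set α)) ＼ ({e'} : Set α)) 4).card :=
    Nat.mul_le_mul_right _ (by omega)
  have h1 := inCount_five_eq_card_biIndepSets_four_minor_of_seriesPair hn h
  have h2 := card_biIndepSets_five_minor_le_outCount_six_of_seriesPair h
  omega

/-- **THE TWELVE-POINT STATEMENT AT EVERY POINT OF A SERIES PAIR** (`#E = 12`, `ρ(E) = 7`). -/
theorem inCount_five_le_outCount_six_of_twelve_of_seriesPair_mem (hn : (gr N).card = 12)
    (hR : rk N (gr N) = 7) {e e' : α} (h : SeriesPair N e e') : inCount N 5 e ≤ outCount N 6 e :=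
  inCount_five_le_outCount_six_of_seriesPair_mem (by omega) (by omega) h

end FiveSeriesMem

end PercRepro.Cogirth
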